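import Literature.Algebra.Lie.PoincareBirkhoffWitt
import Literature.NumberTheory.Automorphic.ChevalleyData
import Mathlib.LinearAlgebra.Quotient.Basic
import Mathlib.Order.Fin.Tuple
import HarnessLib

/-!
# Verma modules for a Chevalley system (PBW model)

Trunk T-AUTOMORPHIC (G25 AutomorphicL); highest-weight theory for Chevalley's existence theorem
(`Literature.NumberTheory.Automorphic.chevalley_existence`, Springer 10.1.1), step 1. Given a
Chevalley system `S : IsChevalleySystem P b k h e` (`ChevalleyData.lean`) in a Lie algebra `L`
and "values" `λ_s ∈ k` of the Cartan elements, the **Verma module**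
`M(λ) = U(L) ⧸ (U(L) 𝔫⁺ + ∑_s U(L) (h_s - λ_s))` (Humphreys §20.3; Bourbaki *Lie* VIII §6.1).
Using the Poincaré–Birkhoff–Witt basis of `U(L)` (`Literature.Algebra.Lie.PBW.pbwBasis`) for
the basis `(h_s, e_α)` ordered *negative roots < Cartan < positive roots* (`PBWIdx`), we prove
that **the classes of the ordered monomials in the negative root vectors form a `k`-basis of
`M(λ)`** (`vermaBasis`): independence through the projection `projT` of `U(L)` onto `U(𝔫⁻)`
(`projT (x^{m⁻} x^{m⁰} x^{m⁺}) = [m⁺ = 0] λ^{m⁰} x^{m⁻}`), which kills the defining left ideal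
(`projT_vermaIdeal`); spanning by reduction of `x^{m⁰} ≡ λ^{m⁰}` and `x^{m⁺} ∈` the ideal. We
also set up the `L`-module structure (`⁅x, v⁆ = ι(x) v`). Everything is proved; [folklore]
(Humphreys §20.3 Thm., Dixmier 7.1).

## Mathlib / Literature

`UniversalEnvelopingAlgebra` (`ι`, `lift`), `Literature.Algebra.Lie.PBW.{word, ordMonomial,
pbwBasis, ι_mul_ι, word_append, ordMonomial_coe_eq_word}`, `Submodule.span`, quotients,
`List.Perm.prod_eq'`, `Multiset.sort`. Mathlib has no Verma modules.
-/

noncomputable section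

open Set Function Finsupp UniversalEnvelopingAlgebra
open Literature.Algebra.Lie.PBW

-- Mathlib idiom (Mathlib/Algebra/Lie/OfAssociative.lean, UniversalEnveloping.lean): the commutator
-- bracket on associative rings such as the enveloping algebra and the base field.
attribute [local instance 100] LieRing.ofAssociativeRing

namespace Literature.NumberTheory.Automorphic

namespace ChevalleyVerma

variable {k : Type*} [Field k]
variable {ι X Y : Type*} [AddCommGroup X] [AddCommGroup Y] [Fintype ι] [DecidableEq ι]
variable {P : RootPairing ι ℤ X Y} (b : P.Base)

/-! ### The ordered index type of the basis `(h_s, e_α)` -/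

/-- The index type of the basis `(h_s, e_α)`: simple roots (Cartan elements) and roots (root
vectors). A type synonym of `b.support ⊕ ι` carrying the order *negative roots < Cartan elements
< positive roots*. [folklore] -/
def PBWIdx : Type _ := b.support ⊕ ι

namespace PBWIdx

variable {b}

/-- Constructor: the index of the Cartan element `h_s`. [folklore] -/
def cartan (s : b.support) : PBWIdx b := Sum.inl s

/-- Constructor: the index of the root vector `e_i`. [folklore] -/
def root (i : ι) : PBWIdx b := Sum.inr i

/-- Destructor to the sum type. [folklore] -/
def toSum (x : PBWIdx b) : b.support ⊕ ι := x

/-- Finiteness of the index type. [folklore] -/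
instance : Fintype (PBWIdx b) := inferInstanceAs (Fintype (b.support ⊕ ι))

/-- Decidable equality of indices. [folklore] -/
instance : DecidableEq (PBWIdx b) := inferInstanceAs (DecidableEq (b.support ⊕ ι))

open scoped Classical in
/-- The class of an index: `0` for negative roots, `1` for Cartan elements, `2` for positive
roots. [folklore] -/
def cls : PBWIdx b → Fin 3 :=
  Sum.elim (fun _ => 1) (fun i => if b.IsPos i then 2 else 0)

omit [Fintype ι] [DecidableEq ι] in
/-- Cartan indices have class `1`. [folklore] -/
@[simp] lemma cls_cartan (s : b.support) : cls (cartan s : PBWIdx b) = 1 := rfl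

omit [Fintype ι] [DecidableEq ι] in
/-- Positive roots have class `2`. [folklore] -/
lemma cls_root_of_isPos {i : ι} (hi : b.IsPos i) : cls (root i : PBWIdx b) = 2 := by
  classical
  change (if b.IsPos i then (2 : Fin 3) else 0) = 2
  rw [if_pos hi]

omit [Fintype ι] [DecidableEq ι] in
/-- Non-positive roots have class `0`. [folklore] -/
lemma cls_root_of_not_isPos {i : ι} (hi : ¬ b.IsPos i) : cls (root i : PBWIdx b) = 0 := by
  classical
  change (if b.IsPos i then (2 : Fin 3) else 0) = 0
  rw [if_neg hi]

/-- An enumeration of the indices. [folklore] -/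
def enum : PBWIdx b → ℕ := fun x => Fintype.equivFin (b.support ⊕ ι) x

omit [DecidableEq ι] in
/-- `enum` is injective. [folklore] -/
lemma enum_injective : Function.Injective (enum (b := b)) :=
  fun _ _ h => (Fintype.equivFin (b.support ⊕ ι)).injective (Fin.ext h)

/-- The sort key `(class, enumeration)` in the lexicographic product. [folklore] -/
def key (x : PBWIdx b) : Fin 3 ×ₗ ℕ := toLex (cls x, enum x)

omit [DecidableEq ι] in
/-- `key` is injective. [folklore] -/
lemma key_injective : Function.Injective (key (b := b)) := by
  intro x y h
  simp only [key, toLex_inj, Prod.mk.injEq] at h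
  exact enum_injective h.2

/-- **The order on the indices**: lexicographic in `(class, enumeration)`, so that negative
roots come first, then the Cartan elements, then the positive roots. [folklore] -/
instance : LinearOrder (PBWIdx b) := LinearOrder.lift' key key_injective

omit [DecidableEq ι] in
/-- Unfolding of the order. [folklore] -/
lemma le_iff_key_le {x y : PBWIdx b} : x ≤ y ↔ key x ≤ key y := Iff.rfl

omit [DecidableEq ι] in
/-- Indices of smaller class are smaller. [folklore] -/
lemma lt_of_cls_lt {x y : PBWIdx b} (h : cls x < cls y) : x < y := by
  rw [lt_iff_le_not_ge, le_iff_key_le, le_iff_key_le, key, key, Prod.Lex.toLex_le_toLex,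
    Prod.Lex.toLex_le_toLex]
  refine ⟨Or.inl h, ?_⟩
  rintro (h' | ⟨h', -⟩)
  · exact lt_asymm h h'
  · exact absurd h' (ne_of_gt h)

omit [DecidableEq ι] in
/-- `x ≤ y` forces `cls x ≤ cls y`. [folklore] -/
lemma cls_le_of_le {x y : PBWIdx b} (h : x ≤ y) : cls x ≤ cls y := by
  rw [le_iff_key_le, key, key, Prod.Lex.toLex_le_toLex] at h
  rcases h with h | ⟨h, -⟩
  · exact h.le
  · exact h.le

end PBWIdx

/-! ### Ordered monomials: multiplicativity along the order -/

section OrdMonomial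

variable {R : Type*} [CommRing R] {σ : Type*} [LinearOrder σ] {L' : Type*} [LieRing L']
  [LieAlgebra R L'] (B : Module.Basis σ R L')

/-- **`x^{m₁ + m₂} = x^{m₁} x^{m₂}` when every index of `m₁` is `≤` every index of `m₂`.**
[folklore] -/
theorem ordMonomial_add_of_forall_le {m₁ m₂ : σ →₀ ℕ}
    (hle : ∀ x ∈ m₁.support, ∀ y ∈ m₂.support, x ≤ y) :
    ordMonomial B (m₁ + m₂) = ordMonomial B m₁ * ordMonomial B m₂ := by
  rw [ordMonomial, ordMonomial, ordMonomial, ← word_append]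
  congr 1
  apply List.Perm.eq_of_pairwise' (r := (· ≤ ·)) (Multiset.pairwise_sort _ _)
  · rw [List.pairwise_append]
    refine ⟨Multiset.pairwise_sort _ _, Multiset.pairwise_sort _ _, fun x hx y hy => hle x ?_ y ?_⟩
    · rw [Multiset.mem_sort, Finsupp.mem_toMultiset] at hx; exact hx
    · rw [Multiset.mem_sort, Finsupp.mem_toMultiset] at hy; exact hy
  · rw [← Multiset.coe_eq_coe, Multiset.sort_eq, ← Multiset.coe_add, Multiset.sort_eq,
      Multiset.sort_eq, Finsupp.toMultiset_add]

omit [LinearOrder σ] in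
/-- Words in pairwise commuting letters only depend on the multiset of letters. [folklore] -/
theorem word_eq_of_perm_of_commute {l₁ l₂ : List σ} (hp : l₁.Perm l₂)
    (hc : ∀ x ∈ l₁, ∀ y ∈ l₁, Commute (UniversalEnvelopingAlgebra.ι R (B x))
      (UniversalEnvelopingAlgebra.ι R (B y))) : word B l₁ = word B l₂ := by
  have hpw : l₁.Pairwise fun x y => Commute (UniversalEnvelopingAlgebra.ι R (B x))
      (UniversalEnvelopingAlgebra.ι R (B y)) := by
    clear hp
    induction l₁ with
    | nil => exact List.Pairwise.nil
    | cons a l ih =>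
      rw [List.pairwise_cons]
      exact ⟨fun y hy => hc a (by simp) y (by simp [hy]),
        ih fun x hx y hy => hc x (by simp [hx]) y (by simp [hy])⟩
  rw [word, word]
  apply List.Perm.prod_eq' (hp.map _)
  rwa [List.pairwise_map]

end OrdMonomial

section OrdMonomialMap

variable {R : Type*} [CommRing R] {σ : Type*} [LinearOrder σ] {L' : Type*} [LieRing L']
  [LieAlgebra R L'] (B : Module.Basis σ R L')

omit [LinearOrder σ] in
/-- **Words along a morphism of Lie algebras** compatible with bases: `U(g)` maps the word of
`l` to the word of `l.map f`. [folklore] -/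
theorem lift_word {τ : Type*} {L'' : Type*} [LieRing L''] [LieAlgebra R L'']
    (B' : Module.Basis τ R L'') (f : τ → σ) (g : L'' →ₗ⁅R⁆ L') (hg : ∀ t, g (B' t) = B (f t))
    (l : List τ) :
    UniversalEnvelopingAlgebra.lift R ((UniversalEnvelopingAlgebra.ι R).comp g) (word B' l) =
      word B (l.map f) := by
  induction l with
  | nil => simp
  | cons a l ih =>
    rw [word_cons, map_mul, ih, List.map_cons, word_cons, UniversalEnvelopingAlgebra.lift_ι_apply,
      LieHom.comp_apply, hg]

/-- **Ordered monomials along an order embedding of index types**: a morphism of Lie algebras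
`g : L'' → L'` mapping a basis `B'` to `B ∘ f` for a strictly monotone `f` maps (through
`U(g)`) the ordered monomial of `n` to the ordered monomial of `n.mapDomain f`. [folklore] -/
theorem ordMonomial_mapDomain {τ : Type*} [LinearOrder τ] {L'' : Type*} [LieRing L''] [LieAlgebra R L'']
    (B' : Module.Basis τ R L'') (f : τ → σ) (hf : StrictMono f) (g : L'' →ₗ⁅R⁆ L')
    (hg : ∀ t, g (B' t) = B (f t)) (n : τ →₀ ℕ) :
    UniversalEnvelopingAlgebra.lift R ((UniversalEnvelopingAlgebra.ι R).comp g) (ordMonomial B' n) =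
      ordMonomial B (n.mapDomain f) := by
  rw [ordMonomial, lift_word B B' f g hg, ordMonomial, ← Finsupp.toMultiset_map,
    ← Multiset.map_sort (s := toMultiset n) (f := f) (r := (· ≤ ·)) (r' := (· ≤ ·))
      (fun a _ c _ => (hf.le_iff_le).symm)]

end OrdMonomialMap

/-! ### The Chevalley system in the enveloping algebra -/

section System

variable {b}
variable {L : Type*} [LieRing L] [LieAlgebra k L] {h : b.support → L} {e : ι → L}
  (S : IsChevalleySystem P b k h e)

local notation "𝓤" => UniversalEnvelopingAlgebra k L
local notation "ιU" => UniversalEnvelopingAlgebra.ι k (L := L)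

include S

/-- **The ordered PBW basis `(h_s, e_α)` of `L`** indexed by `PBWIdx b`. [folklore] -/
def basisPBW : Module.Basis (PBWIdx b) k L := S.basis.reindex (Equiv.refl _)

omit [Fintype ι] [DecidableEq ι] in
/-- The Cartan vectors of the basis. [folklore] -/
@[simp] lemma basisPBW_cartan (s : b.support) : basisPBW S (PBWIdx.cartan s) = h s := by
  rw [basisPBW, Module.Basis.reindex_apply, IsChevalleySystem.coe_basis]
  rfl

omit [Fintype ι] [DecidableEq ι] in
/-- The root vectors of the basis. [folklore] -/
@[simp] lemma basisPBW_root (i : ι) : basisPBW S (PBWIdx.root i) = e i := by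
  rw [basisPBW, Module.Basis.reindex_apply, IsChevalleySystem.coe_basis]
  rfl

omit [Fintype ι] [DecidableEq ι] in
/-- **`ι(h_s) ι(e_α) = ι(e_α) ι(h_s) + ⟨α, α_s^∨⟩ ι(e_α)` in `U(L)`.** [folklore] -/
lemma ιh_mul_ιe (s : b.support) (i : ι) :
    ιU (h s) * ιU (e i) = ιU (e i) * ιU (h s) + (P.pairing i s : k) • ιU (e i) := by
  rw [ι_mul_ι, S.lie_h_e, map_smul]

omit [Fintype ι] [DecidableEq ι] in
/-- The `ι(h_s)` commute. [folklore] -/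
lemma commute_ιh (s t : b.support) : Commute (ιU (h s)) (ιU (h t)) := by
  have := ι_mul_ι (R := k) (h s) (h t)
  rw [S.lie_h_h, map_zero, add_zero] at this
  exact this

/-- The total `α_s^∨`-weight of a list of roots. [folklore] -/
def listWt (s : b.support) (l : List ι) : k := (l.map fun i => (P.pairing i s : k)).sum

omit S [Fintype ι] [DecidableEq ι] in
/-- Weight of the empty list. [folklore] -/
@[simp] lemma listWt_nil (s : b.support) : listWt (P := P) (k := k) s [] = 0 := rfl

omit S [Fintype ι] [DecidableEq ι] in
/-- Weight of a cons. [folklore] -/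
@[simp] lemma listWt_cons (s : b.support) (i : ι) (l : List ι) :
    listWt (P := P) (k := k) s (i :: l) = (P.pairing i s : k) + listWt s l := by
  simp [listWt]

omit [Fintype ι] [DecidableEq ι] in
/-- **`ι(h_s)` acts on a word in root vectors by its total weight**:
`ι(h_s) w = w ι(h_s) + (∑ ⟨α_i, α_s^∨⟩) w` for `w = ι(e_{i₁}) ⋯ ι(e_{i_r})`. [folklore] -/
theorem ιh_mul_word_roots (s : b.support) (l : List ι) :
    ιU (h s) * word (basisPBW S) (l.map PBWIdx.root) =
      word (basisPBW S) (l.map PBWIdx.root) * ιU (h s) +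
        listWt (P := P) (k := k) s l • word (basisPBW S) (l.map PBWIdx.root) := by
  induction l with
  | nil => simp
  | cons i l ih =>
    rw [List.map_cons, word_cons, basisPBW_root, ← mul_assoc, ιh_mul_ιe S, add_mul, mul_assoc, ih,
      listWt_cons, add_smul, smul_mul_assoc, mul_add, mul_smul_comm, ← mul_assoc]
    abel

/-! ### Splitting multi-indices by class -/

/-- The part of a multi-index of class `c`. [folklore] -/
def part (c : Fin 3) (m : PBWIdx b →₀ ℕ) : PBWIdx b →₀ ℕ := m.filter fun x => PBWIdx.cls x = c

omit S [Fintype ι] [DecidableEq ι] in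
/-- Values of a part. [folklore] -/
lemma part_apply (c : Fin 3) (m : PBWIdx b →₀ ℕ) (x : PBWIdx b) :
    part c m x = if PBWIdx.cls x = c then m x else 0 := Finsupp.filter_apply _ _ _

omit S [Fintype ι] [DecidableEq ι] in
/-- The support of a part has the given class. [folklore] -/
lemma cls_eq_of_mem_support_part {c : Fin 3} {m : PBWIdx b →₀ ℕ} {x : PBWIdx b}
    (hx : x ∈ (part c m).support) : PBWIdx.cls x = c := by
  rw [part, Finsupp.support_filter, Finset.mem_filter] at hx
  exact hx.2

omit S [Fintype ι] [DecidableEq ι] in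
/-- **A multi-index is the sum of its three parts.** [folklore] -/
theorem part_add_part_add_part (m : PBWIdx b →₀ ℕ) : part 0 m + part 1 m + part 2 m = m := by
  ext x
  simp only [Finsupp.add_apply, part_apply]
  have h3 : ∀ c : Fin 3, c = 0 ∨ c = 1 ∨ c = 2 := by decide
  rcases h3 (PBWIdx.cls x) with h | h | h <;> simp [h]

omit S [Fintype ι] [DecidableEq ι] in
/-- Parts of a sum of multi-indices with separated classes. [folklore] -/
lemma part_eq_self_of_forall {c : Fin 3} {m : PBWIdx b →₀ ℕ} (hm : ∀ x ∈ m.support, PBWIdx.cls x = c) :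
    part c m = m := by
  ext x
  rw [part_apply]
  split_ifs with h
  · rfl
  · by_contra hne
    exact h (hm x (Finsupp.mem_support_iff.2 (Ne.symm hne)))

omit S [Fintype ι] [DecidableEq ι] in
/-- Parts of a multi-index of a single, different class vanish. [folklore] -/
lemma part_eq_zero_of_forall {c c' : Fin 3} (hcc' : c ≠ c') {m : PBWIdx b →₀ ℕ}
    (hm : ∀ x ∈ m.support, PBWIdx.cls x = c') : part c m = 0 := by
  ext x
  rw [part_apply, Finsupp.zero_apply]
  split_ifs with h
  · by_contra hne
    exact hcc' (h.symm.trans (hm x (Finsupp.mem_support_iff.2 hne)))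
  · rfl

/-- **The ordered monomial factors along the classes**:
`x^m = x^{m⁻} x^{m⁰} x^{m⁺}`. [folklore] -/
theorem ordMonomial_eq_parts (m : PBWIdx b →₀ ℕ) :
    ordMonomial (basisPBW S) m =
      ordMonomial (basisPBW S) (part 0 m) * ordMonomial (basisPBW S) (part 1 m) *
        ordMonomial (basisPBW S) (part 2 m) := by
  conv_lhs => rw [← part_add_part_add_part m]
  rw [ordMonomial_add_of_forall_le, ordMonomial_add_of_forall_le]
  · intro x hx y hy
    exact (PBWIdx.lt_of_cls_lt (by rw [cls_eq_of_mem_support_part hx, cls_eq_of_mem_support_part hy]; decide)).le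
  · intro x hx y hy
    have hy' := cls_eq_of_mem_support_part hy
    have hx' : PBWIdx.cls x = 0 ∨ PBWIdx.cls x = 1 := by
      rcases Finset.mem_union.1 (Finsupp.support_add hx) with h | h
      · exact Or.inl (cls_eq_of_mem_support_part h)
      · exact Or.inr (cls_eq_of_mem_support_part h)
    refine (PBWIdx.lt_of_cls_lt ?_).le
    rw [hy']
    rcases hx' with h | h <;> rw [h] <;> decide

/-! ### Indices by class -/

omit S [Fintype ι] [DecidableEq ι] in
/-- Indices of class `1` are Cartan indices. [folklore] -/
lemma exists_eq_cartan_of_cls_eq_one {x : PBWIdx b} (hx : PBWIdx.cls x = 1) : ∃ s, x = PBWIdx.cartan s := by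
  match x, hx with
  | Sum.inl s, _ => exact ⟨s, rfl⟩
  | Sum.inr i, hx =>
    exfalso
    by_cases hi : b.IsPos i
    · rw [show (Sum.inr i : PBWIdx b) = PBWIdx.root i from rfl, PBWIdx.cls_root_of_isPos hi] at hx
      exact absurd hx (by decide)
    · rw [show (Sum.inr i : PBWIdx b) = PBWIdx.root i from rfl, PBWIdx.cls_root_of_not_isPos hi] at hx
      exact absurd hx (by decide)

omit S [Fintype ι] [DecidableEq ι] in
/-- Indices of class `2` are positive roots. [folklore] -/
lemma exists_eq_root_of_cls_eq_two {x : PBWIdx b} (hx : PBWIdx.cls x = 2) :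
    ∃ i, b.IsPos i ∧ x = PBWIdx.root i := by
  match x, hx with
  | Sum.inl s, hx => exact absurd hx (by change (1 : Fin 3) ≠ 2; decide)
  | Sum.inr i, hx =>
    by_cases hi : b.IsPos i
    · exact ⟨i, hi, rfl⟩
    · rw [show (Sum.inr i : PBWIdx b) = PBWIdx.root i from rfl, PBWIdx.cls_root_of_not_isPos hi] at hx
      exact absurd hx (by decide)

omit S [Fintype ι] [DecidableEq ι] in
/-- Indices of class `0` are non-positive roots. [folklore] -/
lemma exists_eq_root_of_cls_eq_zero {x : PBWIdx b} (hx : PBWIdx.cls x = 0) :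
    ∃ i, ¬ b.IsPos i ∧ x = PBWIdx.root i := by
  match x, hx with
  | Sum.inl s, hx => exact absurd hx (by change (1 : Fin 3) ≠ 0; decide)
  | Sum.inr i, hx =>
    by_cases hi : b.IsPos i
    · rw [show (Sum.inr i : PBWIdx b) = PBWIdx.root i from rfl, PBWIdx.cls_root_of_isPos hi] at hx
      exact absurd hx (by decide)
    · exact ⟨i, hi, rfl⟩

/-! ### Cartan monomials: inserting `ι(h_s)` -/

omit [DecidableEq ι] in
/-- **`x^{m⁰} ι(h_s) = x^{m⁰ + δ_s}`** for a Cartan multi-index `m⁰` (the `ι(h_t)` commute, so the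
order of the letters is immaterial). [folklore] -/
theorem ordMonomial_mul_ιh {m : PBWIdx b →₀ ℕ} (hm : ∀ x ∈ m.support, PBWIdx.cls x = 1) (s : b.support) :
    ordMonomial (basisPBW S) m * ιU (h s) = ordMonomial (basisPBW S) (m + Finsupp.single (PBWIdx.cartan s) 1) := by
  rw [← basisPBW_cartan S s, ← word_singleton, ordMonomial, ← word_append, ordMonomial]
  apply word_eq_of_perm_of_commute
  · rw [← Multiset.coe_eq_coe, ← Multiset.coe_add, Multiset.sort_eq, Multiset.sort_eq,
      Finsupp.toMultiset_add, Finsupp.toMultiset_single, one_nsmul]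
    rfl
  · intro x hx y hy
    have hcls : ∀ z ∈ Multiset.sort (toMultiset m) ++ [PBWIdx.cartan s], PBWIdx.cls z = 1 := by
      intro z hz
      rw [List.mem_append, Multiset.mem_sort, Finsupp.mem_toMultiset, List.mem_singleton] at hz
      rcases hz with hz | rfl
      · exact hm z hz
      · rfl
    obtain ⟨t, rfl⟩ := exists_eq_cartan_of_cls_eq_one (hcls x hx)
    obtain ⟨t', rfl⟩ := exists_eq_cartan_of_cls_eq_one (hcls y hy)
    rw [basisPBW_cartan, basisPBW_cartan]
    exact commute_ιh S t t'

/-! ### The positive nilpotent subalgebra `𝔫⁺` and its enveloping algebra -/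

/-- The positive roots, as a type. [folklore] -/
def PosRoot (b : P.Base) : Type _ := {i : ι // b.IsPos i}

namespace PosRoot

/-- The embedding of positive roots into the PBW index type. [folklore] -/
def emb (i : PosRoot b) : PBWIdx b := PBWIdx.root i.1

omit S [Fintype ι] [DecidableEq ι] in
/-- `emb` is injective. [folklore] -/
lemma emb_injective : Function.Injective (emb (b := b)) := by
  intro i j h
  apply Subtype.ext
  exact Sum.inr_injective h

/-- Finiteness. [folklore] -/
instance : Fintype (PosRoot b) := Fintype.ofFinite {i : ι // b.IsPos i}

/-- Decidable equality. [folklore] -/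
instance : DecidableEq (PosRoot b) := inferInstanceAs (DecidableEq {i : ι // b.IsPos i})

/-- **The order on positive roots**: restriction of the PBW order. [folklore] -/
instance : LinearOrder (PosRoot b) := LinearOrder.lift' emb emb_injective

omit S [DecidableEq ι] in
/-- `emb` is strictly monotone (by definition of the order). [folklore] -/
lemma emb_strictMono : StrictMono (emb (b := b)) := fun _ _ h => h

omit S [Fintype ι] [DecidableEq ι] in
/-- Positive roots have class `2`. [folklore] -/
lemma cls_emb (i : PosRoot b) : PBWIdx.cls (emb i) = 2 := PBWIdx.cls_root_of_isPos i.2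

end PosRoot

omit S [Fintype ι] [DecidableEq ι] in
/-- A sum of two positive roots is not zero. [folklore] -/
lemma root_add_root_ne_zero_of_isPos {i j : ι} (hi : b.IsPos i) (hj : b.IsPos j) :
    P.root i + P.root j ≠ 0 := by
  intro h0
  letI := P.indexNeg
  have hji : P.root j = P.root (-i) := by
    rw [show (-i : ι) = P.reflectionPerm i i from rfl, RootPairing.root_reflectionPerm,
      RootPairing.reflection_apply_self]
    exact eq_neg_of_add_eq_zero_right h0
  have := P.root.injective hji
  rw [this] at hj
  exact ((RootPairing.Base.IsPos.neg_iff_not b i).1 hj) hi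

/-- **The positive nilpotent subalgebra `𝔫⁺ = ∑_{α > 0} k e_α`** (closed under brackets by the
Chevalley relations and the positivity of sums of positive roots). [folklore] -/
def nPlus : LieSubalgebra k L where
  toSubmodule := Submodule.span k (range fun i : PosRoot b => e i.1)
  lie_mem' := by
    intro x y hx hy
    change x ∈ Submodule.span k (range fun i : PosRoot b => e i.1) at hx
    change y ∈ Submodule.span k (range fun i : PosRoot b => e i.1) at hy
    change ⁅x, y⁆ ∈ Submodule.span k (range fun i : PosRoot b => e i.1)
    -- generators
    have hgen : ∀ i j : PosRoot b, ⁅e i.1, e j.1⁆ ∈ Submodule.span k (range fun i : PosRoot b => e i.1) := by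
      intro i j
      by_cases hsum : P.root i.1 + P.root j.1 ∈ range P.root
      · obtain ⟨l, hl⟩ := hsum
        obtain ⟨t, -, ht⟩ := S.exists_lie_e_e_eq_smul i.1 j.1 l hl.symm
        rw [ht]
        exact Submodule.smul_mem _ t (Submodule.subset_span ⟨⟨l, RootPairing.Base.IsPos.add i.2 j.2 hl⟩, rfl⟩)
      · rw [S.lie_e_e_eq_zero i.1 j.1 (root_add_root_ne_zero_of_isPos i.2 j.2) hsum]
        exact Submodule.zero_mem _
    induction hx using Submodule.span_induction generalizing y with
    | mem x hx' =>
      obtain ⟨i, rfl⟩ := hx'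
      induction hy using Submodule.span_induction with
      | mem y hy' => obtain ⟨j, rfl⟩ := hy'; exact hgen i j
      | zero => rw [lie_zero]; exact Submodule.zero_mem _
      | add y z _ _ hy hz => rw [lie_add]; exact Submodule.add_mem _ hy hz
      | smul t y _ hy => rw [lie_smul]; exact Submodule.smul_mem _ t hy
    | zero => rw [zero_lie]; exact Submodule.zero_mem _
    | add x x' _ _ hx hx' => rw [add_lie]; exact Submodule.add_mem _ (hx hy) (hx' hy)
    | smul t x _ hx => rw [smul_lie]; exact Submodule.smul_mem _ t (hx hy)

omit [DecidableEq ι] in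
/-- The root vectors of positive roots lie in `𝔫⁺`. [folklore] -/
lemma e_mem_nPlus (i : PosRoot b) : e i.1 ∈ nPlus S := Submodule.subset_span ⟨i, rfl⟩

/-- The root vectors of the positive roots, as elements of `𝔫⁺`. [folklore] -/
def ePlus (i : PosRoot b) : nPlus S := ⟨e i.1, e_mem_nPlus S i⟩

omit [DecidableEq ι] in
/-- They are linearly independent. [folklore] -/
lemma linearIndependent_ePlus : LinearIndependent k (ePlus S) := by
  apply LinearIndependent.of_comp (nPlus S).toSubmodule.subtype
  have h1 : (nPlus S).toSubmodule.subtype ∘ ePlus S = Sum.elim h e ∘ Sum.inr ∘ Subtype.val := by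
    funext i; rfl
  rw [h1]
  exact (S.linearIndependent.comp _ Sum.inr_injective).comp _ Subtype.val_injective

omit [DecidableEq ι] in
/-- They span `𝔫⁺`. [folklore] -/
lemma span_ePlus : Submodule.span k (range (ePlus S)) = ⊤ := by
  apply Submodule.map_injective_of_injective (nPlus S).toSubmodule.injective_subtype
  rw [Submodule.map_span, Submodule.map_subtype_top]
  congr 1
  ext x
  constructor
  · rintro ⟨_, ⟨i, rfl⟩, rfl⟩; exact ⟨i, rfl⟩
  · rintro ⟨i, rfl⟩; exact ⟨ePlus S i, ⟨i, rfl⟩, rfl⟩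

/-- **The ordered basis `(e_α)_{α > 0}` of `𝔫⁺`.** [folklore] -/
def basisNPlus : Module.Basis (PosRoot b) k (nPlus S) :=
  Module.Basis.mk (linearIndependent_ePlus S) (span_ePlus S).ge

omit [DecidableEq ι] in
/-- Its vectors. [folklore] -/
@[simp] lemma basisNPlus_apply (i : PosRoot b) : basisNPlus S i = ePlus S i := Module.Basis.mk_apply _ _ i

/-- **The morphism `U(𝔫⁺) → U(L)`** induced by the inclusion. [folklore] -/
def inclU : UniversalEnvelopingAlgebra k (nPlus S) →ₐ[k] 𝓤 :=
  UniversalEnvelopingAlgebra.lift k ((UniversalEnvelopingAlgebra.ι k).comp (nPlus S).incl)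

omit [DecidableEq ι] in
/-- `U(𝔫⁺) → U(L)` on words. [folklore] -/
lemma inclU_word (l : List (PosRoot b)) :
    inclU S (word (basisNPlus S) l) = word (basisPBW S) (l.map PosRoot.emb) :=
  lift_word (basisPBW S) (basisNPlus S) PosRoot.emb (nPlus S).incl (fun i => by simp [PosRoot.emb, ePlus]) l

omit [DecidableEq ι] in
/-- `U(𝔫⁺) → U(L)` on ordered monomials. [folklore] -/
lemma inclU_ordMonomial (n : PosRoot b →₀ ℕ) :
    inclU S (ordMonomial (basisNPlus S) n) = ordMonomial (basisPBW S) (n.mapDomain PosRoot.emb) :=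
  ordMonomial_mapDomain (basisPBW S) (basisNPlus S) PosRoot.emb PosRoot.emb_strictMono (nPlus S).incl
    (fun i => by simp [PosRoot.emb, ePlus]) n

/-- **The counit (augmentation) `U(𝔫⁺) → k`** (induced by the zero map). [folklore] -/
def counitN : UniversalEnvelopingAlgebra k (nPlus S) →ₐ[k] k :=
  UniversalEnvelopingAlgebra.lift k (0 : nPlus S →ₗ⁅k⁆ k)

omit [DecidableEq ι] in
/-- The counit on words: `1` on the empty word, `0` otherwise. [folklore] -/
lemma counitN_word (l : List (PosRoot b)) : counitN S (word (basisNPlus S) l) = if l = [] then 1 else 0 := by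
  induction l with
  | nil => simp
  | cons a l ih =>
    rw [word_cons, map_mul, counitN, UniversalEnvelopingAlgebra.lift_ι_apply, LieHom.zero_apply, zero_mul,
      if_neg (List.cons_ne_nil a l)]

/-- The counit on ordered monomials: `1` on the empty one, `0` otherwise. [folklore] -/
lemma counitN_ordMonomial (n : PosRoot b →₀ ℕ) :
    counitN S (ordMonomial (basisNPlus S) n) = if n = 0 then 1 else 0 := by
  rw [ordMonomial, counitN_word]
  have hinj : Function.Injective (Finsupp.toMultiset : (PosRoot b →₀ ℕ) → Multiset (PosRoot b)) :=
    fun x y hxy => by simpa using congrArg Multiset.toFinsupp hxy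
  have hiff : Multiset.sort (toMultiset n) = [] ↔ n = 0 := by
    rw [← Multiset.coe_eq_zero, Multiset.sort_eq, ← Finsupp.toMultiset_zero, hinj.eq_iff]
  by_cases hn : n = 0
  · rw [if_pos hn, if_pos (hiff.2 hn)]
  · rw [if_neg hn, if_neg (fun h => hn (hiff.1 h))]

/-- **Positive words expand in non-empty positive ordered monomials**: a word
`ι(e_{β₁}) ⋯ ι(e_{β_r})`, `r ≥ 1`, in positive root vectors is a `k`-combination of ordered
monomials `x^{n}` with `n ≠ 0` supported on positive roots (PBW in `U(𝔫⁺)`, transported to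
`U(L)`; the coefficient of the empty monomial is the counit, which vanishes on non-empty words).
[folklore] -/
theorem word_pos_mem_span {l : List (PosRoot b)} (hl : l ≠ []) :
    word (basisPBW S) (l.map PosRoot.emb) ∈ Submodule.span k
      {u | ∃ n : PosRoot b →₀ ℕ, n ≠ 0 ∧ u = ordMonomial (basisPBW S) (n.mapDomain PosRoot.emb)} := by
  set w := word (basisNPlus S) l with hw
  set c := (pbwBasis (basisNPlus S)).repr w with hc
  have hrepr : w = ∑ n ∈ c.support, c n • ordMonomial (basisNPlus S) n := by
    have := (pbwBasis (basisNPlus S)).linearCombination_repr w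
    rw [Finsupp.linearCombination_apply, Finsupp.sum] at this
    rw [← hc] at this
    simp only [pbwBasis_apply] at this
    exact this.symm
  -- the coefficient of the empty monomial is the counit of `w`, i.e. `0`
  have h0 : c 0 = 0 := by
    have h1 := congrArg (counitN S) hrepr
    rw [hw, counitN_word, if_neg hl, map_sum] at h1
    simp only [map_smul, counitN_ordMonomial, smul_eq_mul, mul_ite, mul_one, mul_zero] at h1
    rw [Finset.sum_ite_eq' ] at h1
    split_ifs at h1 with hmem
    · exact h1.symm
    · exact Finsupp.notMem_support_iff.1 hmem
  -- apply `U(𝔫⁺) → U(L)`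
  rw [← inclU_word, ← hw, hrepr, map_sum]
  refine Submodule.sum_mem _ fun n hn => ?_
  rw [map_smul, inclU_ordMonomial]
  by_cases hn0 : n = 0
  · subst hn0
    rw [h0, zero_smul]
    exact Submodule.zero_mem _
  · exact Submodule.smul_mem _ _ (Submodule.subset_span ⟨n, hn0, rfl⟩)

/-! ### The projection `T : U(L) → U(𝔫⁻)` -/

/-- The scalar `λ^{m⁰} = ∏_s λ_s ^ {m(h_s)}` of a multi-index. [folklore] -/
def cartanWeight (lam : b.support → k) (m : PBWIdx b →₀ ℕ) : k := ∏ s, lam s ^ m (PBWIdx.cartan s)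

omit S [Fintype ι] [DecidableEq ι] in
/-- `PBWIdx.cartan` is injective. [folklore] -/
lemma cartan_injective : Function.Injective (PBWIdx.cartan (b := b)) := fun _ _ h => Sum.inl_injective h

omit S [Fintype ι] in
/-- `λ^{m + δ_s} = λ_s λ^{m}`. [folklore] -/
lemma cartanWeight_add_single (lam : b.support → k) (m : PBWIdx b →₀ ℕ) (s : b.support) :
    cartanWeight lam (m + Finsupp.single (PBWIdx.cartan s) 1) = lam s * cartanWeight lam m := by
  classical
  unfold cartanWeight
  have hexp : ∀ t : b.support, ((m + Finsupp.single (PBWIdx.cartan s) 1 : PBWIdx b →₀ ℕ) : PBWIdx b → ℕ)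
      (PBWIdx.cartan t) = m (PBWIdx.cartan t) + if t = s then 1 else 0 := by
    intro t
    rw [Finsupp.add_apply, Finsupp.single_apply]
    congr 1
    by_cases ht : t = s
    · subst ht; simp
    · rw [if_neg, if_neg ht]
      exact fun h => ht (cartan_injective h).symm
  have h2 : ∀ t : b.support, lam t ^ ((m + Finsupp.single (PBWIdx.cartan s) 1 : PBWIdx b →₀ ℕ) : PBWIdx b → ℕ)
      (PBWIdx.cartan t) = lam t ^ m (PBWIdx.cartan t) * (if t = s then lam t else 1) := by
    intro t
    rw [hexp, pow_add]
    congr 1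
    split_ifs <;> simp
  rw [Finset.prod_congr rfl fun t _ => h2 t, Finset.prod_mul_distrib, Finset.prod_ite_eq' Finset.univ s,
    if_pos (Finset.mem_univ s), mul_comm]

omit S [Fintype ι] [DecidableEq ι] in
/-- `λ^{m}` only depends on the Cartan part. [folklore] -/
lemma cartanWeight_eq_of_cartan_eq (lam : b.support → k) {m m' : PBWIdx b →₀ ℕ}
    (h : ∀ s, m (PBWIdx.cartan s) = m' (PBWIdx.cartan s)) : cartanWeight lam m = cartanWeight lam m' := by
  unfold cartanWeight
  exact Finset.prod_congr rfl fun s _ => by rw [h s]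

open scoped Classical in
/-- **The projection `T`** of `U(L)` onto `U(𝔫⁻)` attached to the values `λ_s`: on the PBW basis,
`T (x^{m⁻} x^{m⁰} x^{m⁺}) = [m⁺ = 0] λ^{m⁰} x^{m⁻}`. [folklore] -/
def projT (lam : b.support → k) : 𝓤 →ₗ[k] 𝓤 :=
  (pbwBasis (basisPBW S)).constr k fun m =>
    if part 2 m = 0 then cartanWeight lam m • ordMonomial (basisPBW S) (part 0 m) else 0

/-- `T` on an ordered monomial. [folklore] -/
lemma projT_ordMonomial (lam : b.support → k) (m : PBWIdx b →₀ ℕ) :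
    projT S lam (ordMonomial (basisPBW S) m) =
      if part 2 m = 0 then cartanWeight lam m • ordMonomial (basisPBW S) (part 0 m) else 0 := by
  classical
  rw [← pbwBasis_apply, projT, Module.Basis.constr_basis]

/-- `T` kills monomials with a positive part. [folklore] -/
lemma projT_ordMonomial_of_ne (lam : b.support → k) {m : PBWIdx b →₀ ℕ} (hm : part 2 m ≠ 0) :
    projT S lam (ordMonomial (basisPBW S) m) = 0 := by
  rw [projT_ordMonomial, if_neg hm]

/-- **`T` fixes the negative ordered monomials.** [folklore] -/
theorem projT_ordMonomial_neg (lam : b.support → k) {m : PBWIdx b →₀ ℕ}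
    (hm : ∀ x ∈ m.support, PBWIdx.cls x = 0) : projT S lam (ordMonomial (basisPBW S) m) = ordMonomial (basisPBW S) m := by
  rw [projT_ordMonomial, if_pos (part_eq_zero_of_forall (by decide) hm), part_eq_self_of_forall hm]
  have h1 : cartanWeight lam m = 1 := by
    unfold cartanWeight
    refine Finset.prod_eq_one fun s _ => ?_
    have : m (PBWIdx.cartan s) = 0 := by
      by_contra hne
      have := hm _ (Finsupp.mem_support_iff.2 hne)
      rw [PBWIdx.cls_cartan] at this
      exact absurd this (by decide)
    rw [this, pow_zero]
  rw [h1, one_smul]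

/-! ### `T` kills the defining left ideal of the Verma module -/

omit S in
/-- The positive part of a multi-index, as a multi-index on positive roots. [folklore] -/
def restrPos (m : PBWIdx b →₀ ℕ) : PosRoot b →₀ ℕ :=
  (part 2 m).comapDomain PosRoot.emb PosRoot.emb_injective.injOn

omit S [Fintype ι] [DecidableEq ι] in
/-- `(restrPos m).mapDomain emb = m⁺`. [folklore] -/
lemma mapDomain_restrPos (m : PBWIdx b →₀ ℕ) : (restrPos m).mapDomain PosRoot.emb = part 2 m := by
  unfold restrPos
  refine Finsupp.mapDomain_comapDomain (f := PosRoot.emb) PosRoot.emb_injective (part 2 m) fun x hx => ?_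
  obtain ⟨i, hi, rfl⟩ := exists_eq_root_of_cls_eq_two (cls_eq_of_mem_support_part (Finset.mem_coe.1 hx))
  exact ⟨⟨i, hi⟩, rfl⟩

omit S [Fintype ι] [DecidableEq ι] in
/-- `restrPos m = 0 ↔ m⁺ = 0`. [folklore] -/
lemma restrPos_eq_zero_iff (m : PBWIdx b →₀ ℕ) : restrPos m = 0 ↔ part 2 m = 0 := by
  constructor
  · intro h; rw [← mapDomain_restrPos, h, Finsupp.mapDomain_zero]
  · intro h; rw [restrPos]; ext i; rw [Finsupp.comapDomain_apply, h]; rfl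

omit S [DecidableEq ι] in
/-- The sorted list of the positive part, through positive roots. [folklore] -/
lemma sort_part_two (m : PBWIdx b →₀ ℕ) :
    Multiset.sort (toMultiset (part 2 m)) = (Multiset.sort (toMultiset (restrPos m))).map PosRoot.emb := by
  rw [Multiset.map_sort (s := toMultiset (restrPos m)) (f := PosRoot.emb) (r := (· ≤ ·)) (r' := (· ≤ ·))
    (fun a _ c _ => (PosRoot.emb_strictMono.le_iff_le).symm), Finsupp.toMultiset_map, mapDomain_restrPos]

/-- **`x^{m⁺} ι(e_β)` expands in positive ordered monomials with non-zero index** (`β > 0`).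
[folklore] -/
lemma ordMonomial_part_two_mul_ιe_mem (m : PBWIdx b →₀ ℕ) {i : ι} (hi : b.IsPos i) :
    ordMonomial (basisPBW S) (part 2 m) * ιU (e i) ∈ Submodule.span k
      {u | ∃ n : PosRoot b →₀ ℕ, n ≠ 0 ∧ u = ordMonomial (basisPBW S) (n.mapDomain PosRoot.emb)} := by
  set l : List (PosRoot b) := Multiset.sort (toMultiset (restrPos m)) ++ [⟨i, hi⟩] with hl
  have hw : ordMonomial (basisPBW S) (part 2 m) * ιU (e i) = word (basisPBW S) (l.map PosRoot.emb) := by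
    rw [hl, ordMonomial, sort_part_two, List.map_append, word_append, List.map_singleton, word_singleton,
      PosRoot.emb, basisPBW_root]
  rw [hw]
  exact word_pos_mem_span S (by simp [hl])

omit S [Fintype ι] in
/-- Parts of `m⁻ + m⁰ + n⁺`. [folklore] -/
lemma part_two_parts_add (m : PBWIdx b →₀ ℕ) (n : PosRoot b →₀ ℕ) :
    part 2 (part 0 m + part 1 m + n.mapDomain PosRoot.emb) = n.mapDomain PosRoot.emb := by
  have hn : ∀ x ∈ (n.mapDomain PosRoot.emb).support, PBWIdx.cls x = 2 := by
    intro x hx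
    obtain ⟨j, -, rfl⟩ := Finset.mem_image.1 (Finsupp.mapDomain_support hx)
    exact PosRoot.cls_emb j
  rw [part, Finsupp.filter_add, Finsupp.filter_add, ← part, ← part, ← part,
    part_eq_zero_of_forall (c := 2) (c' := 0) (by decide) (fun x hx => cls_eq_of_mem_support_part hx),
    part_eq_zero_of_forall (c := 2) (c' := 1) (by decide) (fun x hx => cls_eq_of_mem_support_part hx),
    part_eq_self_of_forall hn, zero_add, zero_add]

/-- `x^{m⁻} x^{m⁰} x^{n⁺} = x^{m⁻ + m⁰ + n⁺}`. [folklore] -/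
lemma ordMonomial_parts_mul (m : PBWIdx b →₀ ℕ) (n : PosRoot b →₀ ℕ) :
    ordMonomial (basisPBW S) (part 0 m) * ordMonomial (basisPBW S) (part 1 m) *
      ordMonomial (basisPBW S) (n.mapDomain PosRoot.emb) =
        ordMonomial (basisPBW S) (part 0 m + part 1 m + n.mapDomain PosRoot.emb) := by
  have hn : ∀ x ∈ (n.mapDomain PosRoot.emb).support, PBWIdx.cls x = 2 := by
    intro x hx
    obtain ⟨j, -, rfl⟩ := Finset.mem_image.1 (Finsupp.mapDomain_support hx)
    exact PosRoot.cls_emb j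
  rw [ordMonomial_add_of_forall_le, ordMonomial_add_of_forall_le]
  · intro x hx y hy
    exact (PBWIdx.lt_of_cls_lt (by rw [cls_eq_of_mem_support_part hx, cls_eq_of_mem_support_part hy]; decide)).le
  · intro x hx y hy
    have hx' : PBWIdx.cls x = 0 ∨ PBWIdx.cls x = 1 := by
      rcases Finset.mem_union.1 (Finsupp.support_add hx) with h | h
      · exact Or.inl (cls_eq_of_mem_support_part h)
      · exact Or.inr (cls_eq_of_mem_support_part h)
    refine (PBWIdx.lt_of_cls_lt ?_).le
    rw [hn y hy]
    rcases hx' with h | h <;> rw [h] <;> decide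

/-- **`T (x^m ι(e_β)) = 0` for `β > 0`.** [folklore] -/
theorem projT_ordMonomial_mul_ιe (lam : b.support → k) (m : PBWIdx b →₀ ℕ) {i : ι} (hi : b.IsPos i) :
    projT S lam (ordMonomial (basisPBW S) m * ιU (e i)) = 0 := by
  rw [ordMonomial_eq_parts S m, mul_assoc]
  have hmem := ordMonomial_part_two_mul_ιe_mem S m hi
  -- multiply the expansion by `x^{m⁻} x^{m⁰}` on the left and apply `T`
  set M := ordMonomial (basisPBW S) (part 0 m) * ordMonomial (basisPBW S) (part 1 m) with hM
  have key : ∀ u ∈ Submodule.span k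
      {u | ∃ n : PosRoot b →₀ ℕ, n ≠ 0 ∧ u = ordMonomial (basisPBW S) (n.mapDomain PosRoot.emb)},
      projT S lam (M * u) = 0 := by
    intro u hu
    induction hu using Submodule.span_induction with
    | mem u hu =>
      obtain ⟨n, hn0, rfl⟩ := hu
      rw [hM, ordMonomial_parts_mul, projT_ordMonomial_of_ne]
      rw [part_two_parts_add]
      intro h0
      exact hn0 (Finsupp.mapDomain_injective PosRoot.emb_injective (by rw [h0, Finsupp.mapDomain_zero]))
    | zero => rw [mul_zero, map_zero]
    | add u v _ _ hu hv => rw [mul_add, map_add, hu, hv, add_zero]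
    | smul t u _ hu => rw [mul_smul_comm, map_smul, hu, smul_zero]
  exact key _ hmem

omit S [Fintype ι] [DecidableEq ι] in
/-- Parts of `m + δ_s` for a Cartan index. [folklore] -/
lemma part_add_single_cartan (m : PBWIdx b →₀ ℕ) (s : b.support) :
    part 0 (m + Finsupp.single (PBWIdx.cartan s) 1) = part 0 m ∧
    part 1 (m + Finsupp.single (PBWIdx.cartan s) 1) = part 1 m + Finsupp.single (PBWIdx.cartan s) 1 ∧
    part 2 (m + Finsupp.single (PBWIdx.cartan s) 1) = part 2 m := by
  have hsupp : ∀ x ∈ (Finsupp.single (PBWIdx.cartan s) 1 : PBWIdx b →₀ ℕ).support, PBWIdx.cls x = 1 := by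
    intro x hx
    rw [Finsupp.mem_support_single] at hx
    rw [hx.1]; rfl
  refine ⟨?_, ?_, ?_⟩
  · rw [part, Finsupp.filter_add, ← part, ← part, part_eq_zero_of_forall (by decide) hsupp, add_zero]
  · rw [part, Finsupp.filter_add, ← part, ← part, part_eq_self_of_forall hsupp]
  · rw [part, Finsupp.filter_add, ← part, ← part, part_eq_zero_of_forall (by decide) hsupp, add_zero]

/-- **`x^m ι(h_s) = x^{m + δ_s} - (∑_{β ∈ m⁺} ⟨β, α_s^∨⟩) x^m`.** [folklore] -/
theorem ordMonomial_mul_ιh_eq (m : PBWIdx b →₀ ℕ) (s : b.support) :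
    ordMonomial (basisPBW S) m * ιU (h s) =
      ordMonomial (basisPBW S) (m + Finsupp.single (PBWIdx.cartan s) 1) -
        listWt (P := P) (k := k) s ((Multiset.sort (toMultiset (restrPos m))).map fun j : PosRoot b => (j.1 : ι)) •
          ordMonomial (basisPBW S) m := by
  obtain ⟨h0, h1, h2⟩ := part_add_single_cartan m s
  -- the positive part as a word in roots
  set lr : List ι := (Multiset.sort (toMultiset (restrPos m))).map fun j : PosRoot b => (j.1 : ι) with hlr
  have hw : ordMonomial (basisPBW S) (part 2 m) = word (basisPBW S) (lr.map PBWIdx.root) := by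
    rw [hlr, ordMonomial, sort_part_two, List.map_map]
    rfl
  have hcomm : ordMonomial (basisPBW S) (part 2 m) * ιU (h s) =
      ιU (h s) * ordMonomial (basisPBW S) (part 2 m) -
        listWt (P := P) (k := k) s lr • ordMonomial (basisPBW S) (part 2 m) := by
    rw [hw, ιh_mul_word_roots S]
    abel
  rw [ordMonomial_eq_parts S m, mul_assoc, hcomm, mul_sub, ← mul_assoc, mul_assoc (ordMonomial _ (part 0 m)),
    ordMonomial_mul_ιh S (fun x hx => cls_eq_of_mem_support_part hx) s, mul_smul_comm,
    ordMonomial_eq_parts S (m + Finsupp.single (PBWIdx.cartan s) 1), h0, h1, h2]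

/-- **`T (x^m (ι(h_s) - λ_s)) = 0`.** [folklore] -/
theorem projT_ordMonomial_mul_ιh_sub (lam : b.support → k) (m : PBWIdx b →₀ ℕ) (s : b.support) :
    projT S lam (ordMonomial (basisPBW S) m * (ιU (h s) - algebraMap k 𝓤 (lam s))) = 0 := by
  rw [mul_sub, ordMonomial_mul_ιh_eq S, Algebra.algebraMap_eq_smul_one, mul_smul_comm, mul_one,
    map_sub, map_sub, map_smul, map_smul]
  obtain ⟨h0, h1, h2⟩ := part_add_single_cartan m s
  by_cases hpos : part 2 m = 0
  · -- no positive part: the weight sum is empty and the Cartan weights differ by `λ_s`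
    have hr : restrPos m = 0 := (restrPos_eq_zero_iff m).2 hpos
    rw [hr, Finsupp.toMultiset_zero, Multiset.sort_zero, List.map_nil, listWt_nil, zero_smul, sub_zero,
      projT_ordMonomial, if_pos (by rw [h2]; exact hpos), h0, cartanWeight_add_single, projT_ordMonomial,
      if_pos hpos, smul_smul, sub_self]
  · rw [projT_ordMonomial_of_ne S lam (by rw [h2]; exact hpos), projT_ordMonomial_of_ne S lam hpos,
      smul_zero, smul_zero, sub_zero, sub_zero]

/-! ### The Verma module -/

/-- The generators of the defining left ideal: `ι(e_β)` (`β > 0`) and `ι(h_s) - λ_s` (written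
through the basis `basisPBW S`, so that the data are keyed by the Chevalley system). [folklore] -/
def vermaGens (lam : b.support → k) : Set 𝓤 :=
  (range fun i : PosRoot b => ιU (basisPBW S (PosRoot.emb i))) ∪
    range fun s : b.support => ιU (basisPBW S (PBWIdx.cartan s)) - algebraMap k 𝓤 (lam s)

omit [Fintype ι] [DecidableEq ι] in
/-- `ι(e_β)` is a generator for `β > 0`. [folklore] -/
lemma ιe_mem_vermaGens (lam : b.support → k) (i : PosRoot b) : ιU (e i.1) ∈ vermaGens S lam :=
  Or.inl ⟨i, by change ιU (basisPBW S (PBWIdx.root i.1)) = _; rw [basisPBW_root]⟩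

omit [Fintype ι] [DecidableEq ι] in
/-- `ι(h_s) - λ_s` is a generator. [folklore] -/
lemma ιh_sub_mem_vermaGens (lam : b.support → k) (s : b.support) :
    ιU (h s) - algebraMap k 𝓤 (lam s) ∈ vermaGens S lam :=
  Or.inr ⟨s, by change ιU (basisPBW S (PBWIdx.cartan s)) - _ = _; rw [basisPBW_cartan]⟩

/-- **The defining left ideal `U(L) 𝔫⁺ + ∑_s U(L) (h_s - λ_s)` of the Verma module.** [folklore] -/
def vermaIdeal (lam : b.support → k) : Submodule 𝓤 𝓤 := Submodule.span 𝓤 (vermaGens S lam)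

/-- `T (u g) = 0` for every generator `g` and every `u ∈ U(L)`. [folklore] -/
lemma projT_mul_gen (lam : b.support → k) {g : 𝓤} (hg : g ∈ vermaGens S lam) (u : 𝓤) :
    projT S lam (u * g) = 0 := by
  -- expand `u` in the PBW basis
  have hlin : (projT S lam).comp (LinearMap.mulRight k g) = 0 := by
    refine (pbwBasis (basisPBW S)).ext fun m => ?_
    rw [LinearMap.comp_apply, LinearMap.mulRight_apply, pbwBasis_apply, LinearMap.zero_apply]
    rcases hg with ⟨i, rfl⟩ | ⟨s, rfl⟩
    · change projT S lam (ordMonomial (basisPBW S) m * ιU (basisPBW S (PBWIdx.root i.1))) = 0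
      rw [basisPBW_root]
      exact projT_ordMonomial_mul_ιe S lam m i.2
    · change projT S lam (ordMonomial (basisPBW S) m * (ιU (basisPBW S (PBWIdx.cartan s)) - algebraMap k 𝓤 (lam s))) = 0
      rw [basisPBW_cartan]
      exact projT_ordMonomial_mul_ιh_sub S lam m s
  have := LinearMap.congr_fun hlin u
  rwa [LinearMap.comp_apply, LinearMap.mulRight_apply, LinearMap.zero_apply] at this

/-- **`T` kills the defining left ideal.** [folklore] -/
theorem projT_eq_zero_of_mem (lam : b.support → k) {x : 𝓤} (hx : x ∈ vermaIdeal S lam) : projT S lam x = 0 := by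
  -- the set of `x` with `T (u x) = 0` for all `u` is a left ideal containing the generators
  let K : Submodule 𝓤 𝓤 :=
    { carrier := {x | ∀ u : 𝓤, projT S lam (u * x) = 0}
      add_mem' := fun {x y} hx hy u => by rw [mul_add, map_add, hx u, hy u, add_zero]
      zero_mem' := fun u => by rw [mul_zero, map_zero]
      smul_mem' := fun c x hx u => by rw [smul_eq_mul, ← mul_assoc]; exact hx (u * c) }
  have hle : vermaIdeal S lam ≤ K := Submodule.span_le.2 fun g hg u => projT_mul_gen S lam hg u
  have := hle hx 1
  rwa [one_mul] at this

/-- **The Verma module `M(λ) = U(L) ⧸ (U(L) 𝔫⁺ + ∑ U(L)(h_s - λ_s))`.** [folklore] -/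
def Verma (lam : b.support → k) : Type _ := 𝓤 ⧸ vermaIdeal S lam

/-- Additive structure. [folklore] -/
instance (lam : b.support → k) : AddCommGroup (Verma S lam) := inferInstanceAs (AddCommGroup (𝓤 ⧸ vermaIdeal S lam))

/-- `U(L)`-module structure. [folklore] -/
instance (lam : b.support → k) : Module 𝓤 (Verma S lam) := inferInstanceAs (Module 𝓤 (𝓤 ⧸ vermaIdeal S lam))

/-- `k`-module structure. [folklore] -/
instance (lam : b.support → k) : Module k (Verma S lam) := inferInstanceAs (Module k (𝓤 ⧸ vermaIdeal S lam))

/-- Compatibility of the two module structures. [folklore] -/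
instance (lam : b.support → k) : IsScalarTower k 𝓤 (Verma S lam) :=
  inferInstanceAs (IsScalarTower k 𝓤 (𝓤 ⧸ vermaIdeal S lam))

/-- The quotient map `U(L) → M(λ)` (`U(L)`-linear). [folklore] -/
def mkV (lam : b.support → k) : 𝓤 →ₗ[𝓤] Verma S lam := (vermaIdeal S lam).mkQ

omit [Fintype ι] [DecidableEq ι] in
/-- `mkV` is surjective. [folklore] -/
lemma mkV_surjective (lam : b.support → k) : Function.Surjective (mkV S lam) := Submodule.mkQ_surjective _

omit [Fintype ι] [DecidableEq ι] in
/-- The kernel of `mkV`. [folklore] -/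
lemma mkV_eq_zero_iff (lam : b.support → k) (x : 𝓤) : mkV S lam x = 0 ↔ x ∈ vermaIdeal S lam :=
  Submodule.Quotient.mk_eq_zero _

omit [Fintype ι] [DecidableEq ι] in
/-- `mkV` is `k`-linear. [folklore] -/
lemma mkV_smul (lam : b.support → k) (t : k) (x : 𝓤) : mkV S lam (t • x) = t • mkV S lam x :=
  LinearMap.map_smul_of_tower _ t x

/-- **The highest weight vector `v_λ`**: the class of `1`. [folklore] -/
def hwv (lam : b.support → k) : Verma S lam := mkV S lam 1

omit [Fintype ι] [DecidableEq ι] in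
/-- Generators act trivially: `ι(e_β) v = 0`... more precisely `mkV (u g) = 0`. [folklore] -/
lemma mkV_mul_gen (lam : b.support → k) {g : 𝓤} (hg : g ∈ vermaGens S lam) (u : 𝓤) : mkV S lam (u * g) = 0 := by
  rw [mkV_eq_zero_iff]
  exact Submodule.smul_mem _ u (Submodule.subset_span hg)

/-! ### The PBW basis of the Verma module -/

/-- The non-positive roots, as a type (indices of `𝔫⁻`; for a reduced datum these are the
negative roots). [folklore] -/
def NegRoot (b : P.Base) : Type _ := {i : ι // ¬ b.IsPos i}

namespace NegRoot

/-- The embedding into the PBW index type. [folklore] -/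
def emb (i : NegRoot b) : PBWIdx b := PBWIdx.root i.1

omit S [Fintype ι] [DecidableEq ι] in
/-- `emb` is injective. [folklore] -/
lemma emb_injective : Function.Injective (emb (b := b)) := by
  intro i j hij
  apply Subtype.ext
  exact Sum.inr_injective hij

/-- Finiteness. [folklore] -/
instance : Fintype (NegRoot b) := Fintype.ofFinite {i : ι // ¬ b.IsPos i}

/-- Decidable equality. [folklore] -/
instance : DecidableEq (NegRoot b) := inferInstanceAs (DecidableEq {i : ι // ¬ b.IsPos i})

omit S [Fintype ι] [DecidableEq ι] in
/-- Non-positive roots have class `0`. [folklore] -/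
lemma cls_emb (i : NegRoot b) : PBWIdx.cls (emb i) = 0 := PBWIdx.cls_root_of_not_isPos i.2

end NegRoot

omit S [Fintype ι] in
/-- Multi-indices on `𝔫⁻` have class `0`. [folklore] -/
lemma cls_of_mem_support_mapDomain_neg (n : NegRoot b →₀ ℕ) {x : PBWIdx b}
    (hx : x ∈ (n.mapDomain NegRoot.emb).support) : PBWIdx.cls x = 0 := by
  obtain ⟨j, -, rfl⟩ := Finset.mem_image.1 (Finsupp.mapDomain_support hx)
  exact NegRoot.cls_emb j

omit S in
/-- The negative part of a multi-index, as a multi-index on `𝔫⁻`. [folklore] -/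
def restrNeg (m : PBWIdx b →₀ ℕ) : NegRoot b →₀ ℕ :=
  (part 0 m).comapDomain NegRoot.emb NegRoot.emb_injective.injOn

omit S [Fintype ι] [DecidableEq ι] in
/-- `(restrNeg m).mapDomain emb = m⁻`. [folklore] -/
lemma mapDomain_restrNeg (m : PBWIdx b →₀ ℕ) : (restrNeg m).mapDomain NegRoot.emb = part 0 m := by
  unfold restrNeg
  refine Finsupp.mapDomain_comapDomain (f := NegRoot.emb) NegRoot.emb_injective (part 0 m) fun x hx => ?_
  obtain ⟨i, hi, rfl⟩ := exists_eq_root_of_cls_eq_zero (cls_eq_of_mem_support_part (Finset.mem_coe.1 hx))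
  exact ⟨⟨i, hi⟩, rfl⟩

/-- **The PBW vectors `v_n = [x^n]` of the Verma module**, `n` a multi-index on `𝔫⁻`. [folklore] -/
def vermaVec (lam : b.support → k) (n : NegRoot b →₀ ℕ) : Verma S lam :=
  mkV S lam (ordMonomial (basisPBW S) (n.mapDomain NegRoot.emb))

omit [DecidableEq ι] in
/-- The highest weight vector is `v_0`. [folklore] -/
lemma hwv_eq_vermaVec_zero (lam : b.support → k) : hwv S lam = vermaVec S lam 0 := by
  rw [vermaVec, Finsupp.mapDomain_zero, ordMonomial_zero]; rfl

omit [Fintype ι] [DecidableEq ι] in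
/-- Finite `k`-linear combinations pass through `mkV`. [folklore] -/
lemma mkV_sum_smul (lam : b.support → k) {α : Type*} (t : Finset α) (g : α → k) (f : α → 𝓤) :
    mkV S lam (∑ a ∈ t, g a • f a) = ∑ a ∈ t, g a • mkV S lam (f a) := by
  rw [map_sum]
  exact Finset.sum_congr rfl fun a _ => mkV_smul S lam (g a) (f a)

/-- **The PBW vectors are linearly independent** (apply the projection `T`, which kills the ideal
and fixes negative monomials, then PBW in `U(L)`). [folklore] -/
theorem linearIndependent_vermaVec (lam : b.support → k) : LinearIndependent k (vermaVec S lam) := by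
  rw [linearIndependent_iff']
  intro t g hg n hn
  -- lift the relation to `U(L)`
  have hmem : ∑ a ∈ t, g a • ordMonomial (basisPBW S) (a.mapDomain NegRoot.emb) ∈ vermaIdeal S lam := by
    rw [← mkV_eq_zero_iff, mkV_sum_smul]
    exact hg
  have hT := projT_eq_zero_of_mem S lam hmem
  rw [map_sum] at hT
  simp only [map_smul] at hT
  have hT' : ∑ a ∈ t, g a • ordMonomial (basisPBW S) (a.mapDomain NegRoot.emb) = 0 := by
    rw [← hT]
    refine Finset.sum_congr rfl fun a _ => ?_
    rw [projT_ordMonomial_neg S lam (fun x hx => cls_of_mem_support_mapDomain_neg a hx)]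
  -- PBW independence in `U(L)`
  have hli : LinearIndependent k fun n : NegRoot b →₀ ℕ => ordMonomial (basisPBW S) (n.mapDomain NegRoot.emb) := by
    have := (pbwBasis (basisPBW S)).linearIndependent.comp _ (Finsupp.mapDomain_injective NegRoot.emb_injective)
    have heq : (⇑(pbwBasis (basisPBW S)) ∘ mapDomain NegRoot.emb) =
        fun n : NegRoot b →₀ ℕ => ordMonomial (basisPBW S) (n.mapDomain NegRoot.emb) := by
      funext n
      rw [Function.comp_apply, pbwBasis_apply]
    rwa [heq] at this
  exact linearIndependent_iff'.1 hli t g hT' n hn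

/-- **Monomials with a positive part vanish in `M(λ)`** (they end with some `ι(e_β)`, `β > 0`).
[folklore] -/
theorem mkV_ordMonomial_of_part_two_ne (lam : b.support → k) {m : PBWIdx b →₀ ℕ} (hm : part 2 m ≠ 0) :
    mkV S lam (ordMonomial (basisPBW S) m) = 0 := by
  set l : List (PosRoot b) := Multiset.sort (toMultiset (restrPos m)) with hl
  have hlne : l ≠ [] := by
    intro h0
    apply hm
    rw [← mapDomain_restrPos, show restrPos m = 0 from ?_, Finsupp.mapDomain_zero]
    have hinj : Function.Injective (Finsupp.toMultiset : (PosRoot b →₀ ℕ) → Multiset (PosRoot b)) :=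
      fun x y hxy => by simpa using congrArg Multiset.toFinsupp hxy
    apply hinj
    rw [Finsupp.toMultiset_zero, ← Multiset.sort_eq (r := (· ≤ ·)) (toMultiset (restrPos m)), ← hl, h0]
    rfl
  obtain ⟨l', j, hl'⟩ : ∃ l' j, l = l' ++ [j] := by
    rcases List.eq_nil_or_concat l with h0 | ⟨l', j, h⟩
    · exact absurd h0 hlne
    · exact ⟨l', j, by rw [h, List.concat_eq_append]⟩
  have hw : ordMonomial (basisPBW S) (part 2 m) = word (basisPBW S) (l'.map PosRoot.emb) * ιU (e j.1) := by
    rw [ordMonomial, sort_part_two, ← hl, hl', List.map_append, word_append, List.map_singleton, word_singleton,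
      PosRoot.emb, basisPBW_root]
  rw [ordMonomial_eq_parts S m, hw, ← mul_assoc]
  exact mkV_mul_gen S lam (ιe_mem_vermaGens S lam j) _

/-- **Reduction of the Cartan part**: `[x^{m⁻} x^{m⁰}] = λ^{m⁰} [x^{m⁻}]` in `M(λ)`. [folklore] -/
theorem mkV_ordMonomial_of_part_two_eq (lam : b.support → k) {m : PBWIdx b →₀ ℕ} (hm : part 2 m = 0) :
    mkV S lam (ordMonomial (basisPBW S) m) = cartanWeight lam m • mkV S lam (ordMonomial (basisPBW S) (part 0 m)) := by
  -- induction on the degree of the Cartan part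
  suffices key : ∀ (d : ℕ) (m : PBWIdx b →₀ ℕ), part 2 m = 0 → (part 1 m).degree = d →
      mkV S lam (ordMonomial (basisPBW S) m) = cartanWeight lam m • mkV S lam (ordMonomial (basisPBW S) (part 0 m)) from
    key _ m hm rfl
  intro d
  induction d with
  | zero =>
    intro m hm hd
    rw [Finsupp.degree_eq_zero_iff] at hd
    have hm0 : m = part 0 m := by
      conv_lhs => rw [← part_add_part_add_part m]
      rw [hd, hm, add_zero, add_zero]
    have hw : cartanWeight lam m = 1 := by
      unfold cartanWeight
      refine Finset.prod_eq_one fun s _ => ?_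
      have : m (PBWIdx.cartan s) = 0 := by
        have := DFunLike.congr_fun hd (PBWIdx.cartan s)
        rw [part_apply, if_pos (PBWIdx.cls_cartan s)] at this
        exact this
      rw [this, pow_zero]
    rw [hw, one_smul, ← hm0]
  | succ d ih =>
    intro m hm hd
    -- split off a Cartan index
    obtain ⟨x, hx⟩ : ∃ x, x ∈ (part 1 m).support := by
      by_contra! h0
      have : part 1 m = 0 := Finsupp.support_eq_empty.1 (Finset.eq_empty_of_forall_notMem h0)
      rw [this, map_zero] at hd
      exact Nat.succ_ne_zero d hd.symm
    obtain ⟨s, rfl⟩ := exists_eq_cartan_of_cls_eq_one (cls_eq_of_mem_support_part hx)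
    have hms : 1 ≤ m (PBWIdx.cartan s) := by
      have := Finsupp.mem_support_iff.1 hx
      rw [part_apply, if_pos (PBWIdx.cls_cartan s)] at this
      omega
    set m' := m - Finsupp.single (PBWIdx.cartan s) 1 with hm'
    have hmm' : m = m' + Finsupp.single (PBWIdx.cartan s) 1 := by
      ext y
      rw [Finsupp.add_apply, hm', Finsupp.tsub_apply, Finsupp.single_apply]
      split_ifs with hy
      · subst hy; omega
      · omega
    obtain ⟨h0, h1, h2⟩ := part_add_single_cartan m' s
    rw [← hmm'] at h0 h1 h2
    have hm'2 : part 2 m' = 0 := by rw [← h2]; exact hm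
    have hd' : (part 1 m').degree = d := by
      have := congrArg Finsupp.degree h1
      rw [map_add, Finsupp.degree_single, hd] at this
      omega
    -- `x^m = x^{m'} ι(h_s)` and `ι(h_s) ≡ λ_s`
    have hxm : ordMonomial (basisPBW S) m = ordMonomial (basisPBW S) m' * ιU (h s) := by
      rw [ordMonomial_mul_ιh_eq S m' s, (restrPos_eq_zero_iff m').2 hm'2, Finsupp.toMultiset_zero,
        Multiset.sort_zero, List.map_nil, listWt_nil, zero_smul, sub_zero, ← hmm']
    have hred : mkV S lam (ordMonomial (basisPBW S) m' * ιU (h s)) = lam s • mkV S lam (ordMonomial (basisPBW S) m') := by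
      have h3 := mkV_mul_gen S lam (ιh_sub_mem_vermaGens S lam s) (ordMonomial (basisPBW S) m')
      rw [mul_sub, map_sub, sub_eq_zero, Algebra.algebraMap_eq_smul_one, mul_smul_comm, mul_one, mkV_smul] at h3
      exact h3
    rw [hxm, hred, ih m' hm'2 hd', smul_smul, h0, hmm', cartanWeight_add_single]

/-- **The PBW vectors span `M(λ)`.** [folklore] -/
theorem span_vermaVec (lam : b.support → k) : Submodule.span k (range (vermaVec S lam)) = ⊤ := by
  rw [eq_top_iff]
  intro v _
  obtain ⟨u, rfl⟩ := mkV_surjective S lam v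
  -- expand `u` in the PBW basis
  have hu : u = ∑ m ∈ ((pbwBasis (basisPBW S)).repr u).support,
      (pbwBasis (basisPBW S)).repr u m • ordMonomial (basisPBW S) m := by
    have := (pbwBasis (basisPBW S)).linearCombination_repr u
    rw [Finsupp.linearCombination_apply, Finsupp.sum] at this
    simp only [pbwBasis_apply] at this
    exact this.symm
  rw [hu, mkV_sum_smul]
  refine Submodule.sum_mem _ fun m _ => Submodule.smul_mem _ _ ?_
  by_cases hm : part 2 m = 0
  · rw [mkV_ordMonomial_of_part_two_eq S lam hm, ← mapDomain_restrNeg]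
    exact Submodule.smul_mem _ _ (Submodule.subset_span ⟨restrNeg m, rfl⟩)
  · rw [mkV_ordMonomial_of_part_two_ne S lam hm]
    exact Submodule.zero_mem _

/-- **The PBW basis `([x^n])_{n : 𝔫⁻-multi-indices}` of the Verma module `M(λ)`**
(Humphreys §20.3 Thm. (b); Dixmier 7.1.8). [folklore] -/
def vermaBasis (lam : b.support → k) : Module.Basis (NegRoot b →₀ ℕ) k (Verma S lam) :=
  Module.Basis.mk (linearIndependent_vermaVec S lam) (span_vermaVec S lam).ge

/-- The vectors of the basis. [folklore] -/
@[simp] lemma vermaBasis_apply (lam : b.support → k) (n : NegRoot b →₀ ℕ) :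
    vermaBasis S lam n = vermaVec S lam n := Module.Basis.mk_apply _ _ n

/-- **The highest weight vector is non-zero.** [folklore] -/
theorem hwv_ne_zero (lam : b.support → k) : hwv S lam ≠ 0 := by
  rw [hwv_eq_vermaVec_zero, ← vermaBasis_apply]
  exact (vermaBasis S lam).ne_zero 0

/-! ### The `L`-module structure of the Verma module -/

/-- **`L` acts on `M(λ)` through `U(L)`**: `⁅x, v⁆ = ι(x) v`. [folklore] -/
instance instLieRingModuleVerma (lam : b.support → k) : LieRingModule L (Verma S lam) where
  bracket x v := ιU x • v
  add_lie x y v := by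
    change ιU (x + y) • v = ιU x • v + ιU y • v
    rw [map_add, add_smul]
  lie_add x v w := by
    change ιU x • (v + w) = ιU x • v + ιU x • w
    rw [smul_add]
  leibniz_lie x y v := by
    change ιU x • ιU y • v = ιU ⁅x, y⁆ • v + ιU y • ιU x • v
    rw [← mul_smul, ι_mul_ι, add_smul, mul_smul, add_comm]

omit [Fintype ι] [DecidableEq ι] in
/-- Unfolding of the bracket. [folklore] -/
lemma lie_def (lam : b.support → k) (x : L) (v : Verma S lam) : ⁅x, v⁆ = ιU x • v := rfl

omit [Fintype ι] [DecidableEq ι] in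
/-- The bracket with a class: `⁅x, [u]⁆ = [ι(x) u]`. [folklore] -/
lemma lie_mkV (lam : b.support → k) (x : L) (u : 𝓤) : ⁅x, mkV S lam u⁆ = mkV S lam (ιU x * u) := by
  rw [lie_def, ← smul_eq_mul, LinearMap.map_smul]

/-- **`M(λ)` is a Lie module over `k`.** [folklore] -/
instance instLieModuleVerma (lam : b.support → k) : LieModule k L (Verma S lam) where
  smul_lie t x v := by
    rw [lie_def, lie_def, map_smul, smul_assoc]
  lie_smul t x v := by
    rw [lie_def, lie_def, smul_comm]

omit [Fintype ι] [DecidableEq ι] in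
/-- **The defining relations of the highest weight vector**: `e_β v_λ = 0` for `β > 0`.
[folklore] -/
theorem lie_e_hwv_of_isPos (lam : b.support → k) {i : ι} (hi : b.IsPos i) : ⁅e i, hwv S lam⁆ = 0 := by
  rw [hwv, lie_mkV, mul_one]
  have := mkV_mul_gen S lam (ιe_mem_vermaGens S lam ⟨i, hi⟩) 1
  rwa [one_mul] at this

omit [Fintype ι] [DecidableEq ι] in
/-- **`h_s v_λ = λ_s v_λ`.** [folklore] -/
theorem lie_h_hwv (lam : b.support → k) (s : b.support) : ⁅h s, hwv S lam⁆ = lam s • hwv S lam := by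
  rw [hwv, lie_mkV, mul_one]
  have h3 := mkV_mul_gen S lam (ιh_sub_mem_vermaGens S lam s) 1
  rw [one_mul, map_sub, sub_eq_zero, Algebra.algebraMap_eq_smul_one, mkV_smul] at h3
  exact h3

omit [Fintype ι] [DecidableEq ι] in
/-- **`M(λ)` is generated by `v_λ`**: every vector is `u v_λ` for some `u ∈ U(L)`. [folklore] -/
theorem exists_smul_hwv_eq (lam : b.support → k) (v : Verma S lam) : ∃ u : 𝓤, u • hwv S lam = v := by
  obtain ⟨u, rfl⟩ := mkV_surjective S lam v
  exact ⟨u, by rw [hwv, ← LinearMap.map_smul, smul_eq_mul, mul_one]⟩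

end System

end ChevalleyVerma

end Literature.NumberTheory.Automorphic
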